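import Summits.CriticalPhenomena.PercolationContinuityZ3.Theorems.PercNearOneGluingNoHeavyLowerTailSahiGridPatternCellAtoms

/-!
# `NoHeavyLowerTail` (crux stmt-CriticalPhenomena-4575), Sahi programme P1: **RECTANGLE (MAX-TENSOR) CERTIFICATES FOR JUNTA CYLINDERS ARE
# SOUND IN EVERY DIMENSION** — the `(†⁺)_k` certificate of a first slot `U ⊆ [3]^k` proves `U × [3]^n` good for all `n`

Support file (Sahi cell, seat `prim-sahi-p1`, generation 15; `--supports stmt-CriticalPhenomena-4575`).  Pure proofs, NO definitions, no `sorry`,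
standard axioms.  Vocabulary of `…SahiGridPattern{CellForm,CellAtoms}` (`cylSet`, `sect`, `cellT`, `cellN`, `pairT`, `pairN`, `lamU`, `thetaVal`,
`tgtT`, `tgtN`).

THE MATHEMATICS.  The uniform certificate of generation 11, `(†)_k(U)`: "there is `h ≥ 0` with `diag(λ_U) − h` and `h − Θ_U` in the MINIMAL tensor
cone `K*⊗K* = cone{g⊗g′}`", was refuted at `k = 4` by the census (CENSUS §41, W53: `U = V×V`, `V′×V`, and a random class).  The census' repair
(W54, 2026-08-22) replaces the minimal by the MAXIMAL tensor cone `(K ⊗_min K)* = {M : M(A×B) ≥ 0 for all up-sets A, B}` ("rectangle-copositive"):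
  `(†⁺)_k(U)`:  ∃ `h ≥ 0` on `[3]^k × [3]^k` with  `Σ_{q∈A∩B} λ_U(q) ≥ h(A×B)`  and  `h(A×B) ≥ Θ_U(A×B)`  for ALL up-sets `A, B ⊆ [3]^k`,
and decides it per `U` by a cutting-plane LP with an EXHAUSTIVE exact oracle (all 17 792 748 up-sets `A` × exact min-weight closure over `B`); for
`U = V×V` it found and verified (two engines, exact integers, `h` with 460 nonzero cells, total mass 1024) such an `h` (kit j149924 / j150530,
`prim-sahi-census/comb/w54`).  THIS FILE PROVES THE SOUNDNESS OF THAT CERTIFICATE NOTION, for every `k` and `n`: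
  **`sStarD_cylSet_nonneg_of_rectCert`**: `(†⁺)_k(U)` (the three displayed hypotheses on `h`) ⟹ `0 ≤ sStarD (U × [3]^n) B C` for all up-sets
  `B, C ⊆ [3]^{n+k}` and every `n`.
Proof (three lines on top of the cell form `sStarD_cylSet_eq_pair`): the cell statistics are RECTANGLE MIXTURES over the sections —
`pairT M B C = 2^n Σ_ξ M(B^ξ × C^ξ)` and `pairN M B C = Σ_{ξ δ̸ η} M(B^ξ × C^η)` (`pairT_eq_sum_sect`, `pairN_eq_sum_sect`), the sections being up-sets
— so `pairT (diag λ_U) ≥ pairT h` and `pairN (−Θ_U) ≥ −pairN h` by rectangle-copositivity, while `pairT h ≥ pairN h` by `h ≥ 0` and coefficientwise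
Harris on the fibres (`cellN_le_cellT`); summing, `sStarD = pairT(diag λ_U) + pairN(−Θ_U) ≥ pairT h − pairN h ≥ 0`.
So every `(†⁺)_k`-certificate the census produces is, through this theorem, a proof that the junta cylinder is a good first slot of the pattern
functional in EVERY dimension (the verification of the two rectangle-copositivity hypotheses for a concrete `h` is a finite computation over pairs of
up-sets of `[3]^k`; for `k = 4` it is certificate-grade external computation today).  `(†)_k ⟹ (†⁺)_k` (a `K*⊗K*` element is rectangle-copositive), so
this also re-derives the generation-11 principle `cylGood_of_cylCheck` abstractly.  Nothing here asserts `PatternPos d` for `d ≥ 4` or `(†⁺)_k(U)` for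
any particular `U`. [this work]
-/

namespace Summit.CriticalPhenomena.PercolationContinuityZ3.Theorems.SahiGridPattern

open Finset SahiGrid3
open scoped BigOperators

variable {n k : ℕ}

/-! ### Cell statistics are rectangle mixtures over the sections -/

/-- `Σ_q 1_S(q)·f(q) = Σ_{q∈S} f(q)` (bookkeeping). [this work] -/
theorem sum_ind_mul_eq_sum_mem {Y : Type*} [Fintype Y] [DecidableEq Y] (S : Finset Y) (f : Y → ℤ) :
    (∑ q, ind S q * f q) = ∑ q ∈ S, f q := by
  have h : ∀ q, ind S q * f q = if q ∈ S then f q else 0 := fun q => by unfold ind; split_ifs <;> simp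
  simp_rw [h]
  rw [Finset.sum_ite_mem, Finset.univ_inter]

/-- A bilinear cell pairing against the indicator products of two sections is the RECTANGLE VALUE `M(B^ξ × C^η)`. [this work] -/
theorem sum_sum_mul_ind_glue_eq (M : Pd k → Pd k → ℤ) (B C : Finset (Pd (n + k))) (ξ η : Pd n) :
    (∑ q : Pd k, ∑ r : Pd k, M q r * (ind B (glue ξ q) * ind C (glue η r))) = ∑ q ∈ sect B ξ, ∑ r ∈ sect C η, M q r := by
  have h1 : ∀ q : Pd k, (∑ r : Pd k, M q r * (ind B (glue ξ q) * ind C (glue η r))) =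
      ind (sect B ξ) q * ∑ r ∈ sect C η, M q r := by
    intro q
    rw [← sum_ind_mul_eq_sum_mem (sect C η) (M q), Finset.mul_sum]
    refine Finset.sum_congr rfl fun r _ => ?_
    rw [ind_sect, ind_sect]; ring
  simp_rw [h1]
  exact sum_ind_mul_eq_sum_mem (sect B ξ) _

/-- **`pairT` is a rectangle mixture**: `pairT M B C = 2^n Σ_ξ M(B^ξ × C^ξ)`. [this work] -/
theorem pairT_eq_sum_sect (M : Pd k → Pd k → ℤ) (B C : Finset (Pd (n + k))) :
    pairT M B C = 2 ^ n * ∑ ξ : Pd n, ∑ q ∈ sect B ξ, ∑ r ∈ sect C ξ, M q r := by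
  rw [pairT_expand]
  simp_rw [sum_sum_mul_ind_glue_eq]

/-- **`pairN` is a rectangle mixture**: `pairN M B C = Σ_{ξ δ̸ η} M(B^ξ × C^η)`. [this work] -/
theorem pairN_eq_sum_sect (M : Pd k → Pd k → ℤ) (B C : Finset (Pd (n + k))) :
    pairN M B C = ∑ ξ : Pd n, ∑ η : Pd n, (if TotDist ξ η = true then (1:ℤ) else 0) * ∑ q ∈ sect B ξ, ∑ r ∈ sect C η, M q r := by
  rw [pairN_expand]
  simp_rw [sum_sum_mul_ind_glue_eq]

/-- The diagonal target pairs to `2^n Σ_ξ Σ_{q ∈ B^ξ ∩ C^ξ} λ_U(q)`. [this work] -/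
theorem pairT_tgtT_eq_sum_sect (U : Finset (Pd k)) (B C : Finset (Pd (n + k))) :
    pairT (tgtT U) B C = 2 ^ n * ∑ ξ : Pd n, ∑ q ∈ sect B ξ ∩ sect C ξ, lamU U q := by
  rw [pairT_eq_sum_sect]
  congr 1
  refine Finset.sum_congr rfl fun ξ _ => ?_
  unfold tgtT
  have hin : ∀ q : Pd k, (∑ r ∈ sect C ξ, (if q = r then lamU U q else 0)) = if q ∈ sect C ξ then lamU U q else 0 := fun q =>
    Finset.sum_ite_eq (sect C ξ) q (fun _ => lamU U q)
  simp_rw [hin]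
  exact Finset.sum_ite_mem (sect B ξ) (sect C ξ) (fun q => lamU U q)

/-- `pairT h ≥ pairN h` for an entrywise nonnegative `h` (coefficientwise Harris on every fibre pair). [this work] -/
theorem pairN_le_pairT_of_nonneg {h : Pd k → Pd k → ℤ} (hh : ∀ q r, 0 ≤ h q r)
    {B C : Finset (Pd (n + k))} (hB : IsUpperSet (B : Set (Pd (n + k)))) (hC : IsUpperSet (C : Set (Pd (n + k)))) :
    pairN h B C ≤ pairT h B C := by
  unfold pairT pairN
  exact Finset.sum_le_sum fun q _ => Finset.sum_le_sum fun r _ => mul_le_mul_of_nonneg_left (cellN_le_cellT hB hC q r) (hh q r)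

/-! ### Soundness of rectangle certificates -/

/-- **RECTANGLE (MAX-TENSOR) CERTIFICATES ARE SOUND, every `k` and `n`** (the census' `(†⁺)_k(U) ⟹` good in every dimension):
if `h ≥ 0` on `[3]^k × [3]^k` satisfies, for all up-sets `A, A′ ⊆ [3]^k`,
`h(A × A′) ≤ Σ_{q ∈ A ∩ A′} λ_U(q)` and `Θ_U(A × A′) ≤ h(A × A′)`,
then `0 ≤ sStarD (U × [3]^n) B C` for all up-sets `B, C ⊆ [3]^{n+k}`. [this work] -/
theorem sStarD_cylSet_nonneg_of_rectCert (U : Finset (Pd k)) (h : Pd k → Pd k → ℤ) (hh : ∀ q r, 0 ≤ h q r)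
    (hT : ∀ A A' : Finset (Pd k), IsUpperSet (A : Set (Pd k)) → IsUpperSet (A' : Set (Pd k)) →
      (∑ q ∈ A, ∑ r ∈ A', h q r) ≤ ∑ q ∈ A ∩ A', lamU U q)
    (hN : ∀ A A' : Finset (Pd k), IsUpperSet (A : Set (Pd k)) → IsUpperSet (A' : Set (Pd k)) →
      (∑ q ∈ A, ∑ r ∈ A', thetaVal U q r) ≤ ∑ q ∈ A, ∑ r ∈ A', h q r)
    {B C : Finset (Pd (n + k))} (hB : IsUpperSet (B : Set (Pd (n + k)))) (hC : IsUpperSet (C : Set (Pd (n + k)))) :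
    0 ≤ sStarD (cylSet U : Finset (Pd (n + k))) B C := by
  have h1 : pairT h B C ≤ pairT (tgtT U) B C := by
    rw [pairT_eq_sum_sect, pairT_tgtT_eq_sum_sect]
    exact mul_le_mul_of_nonneg_left
      (Finset.sum_le_sum fun ξ _ => hT _ _ (isUpperSet_sect hB ξ) (isUpperSet_sect hC ξ)) (pow_nonneg (by norm_num) n)
  have h2 : -pairN h B C ≤ pairN (tgtN U) B C := by
    have e : pairN (tgtN U) B C = -pairN (thetaVal U) B C := by
      unfold pairN tgtN; simp only [neg_mul, Finset.sum_neg_distrib]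
    rw [e, neg_le_neg_iff, pairN_eq_sum_sect, pairN_eq_sum_sect]
    refine Finset.sum_le_sum fun ξ _ => Finset.sum_le_sum fun η _ => mul_le_mul_of_nonneg_left
      (hN _ _ (isUpperSet_sect hB ξ) (isUpperSet_sect hC η)) ?_
    split_ifs <;> norm_num
  have h3 := pairN_le_pairT_of_nonneg hh hB hC
  rw [sStarD_cylSet_eq_pair]
  linarith

/-- The same with the certificate inequalities phrased as nonnegativity of the two rectangle functionals
`F_T(A,A′) = Σ_{A∩A′} λ_U − h(A×A′) ≥ 0`, `F_N(A,A′) = h(A×A′) − Θ_U(A×A′) ≥ 0` (the census' notation). [this work] -/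
theorem sStarD_cylSet_nonneg_of_rectCert' (U : Finset (Pd k)) (h : Pd k → Pd k → ℤ) (hh : ∀ q r, 0 ≤ h q r)
    (hT : ∀ A A' : Finset (Pd k), IsUpperSet (A : Set (Pd k)) → IsUpperSet (A' : Set (Pd k)) →
      0 ≤ (∑ q ∈ A ∩ A', lamU U q) - ∑ q ∈ A, ∑ r ∈ A', h q r)
    (hN : ∀ A A' : Finset (Pd k), IsUpperSet (A : Set (Pd k)) → IsUpperSet (A' : Set (Pd k)) →
      0 ≤ (∑ q ∈ A, ∑ r ∈ A', h q r) - ∑ q ∈ A, ∑ r ∈ A', thetaVal U q r)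
    {B C : Finset (Pd (n + k))} (hB : IsUpperSet (B : Set (Pd (n + k)))) (hC : IsUpperSet (C : Set (Pd (n + k)))) :
    0 ≤ sStarD (cylSet U : Finset (Pd (n + k))) B C :=
  sStarD_cylSet_nonneg_of_rectCert U h hh (fun A A' hA hA' => sub_nonneg.1 (hT A A' hA hA'))
    (fun A A' hA hA' => sub_nonneg.1 (hN A A' hA hA')) hB hC


/-! ### Appendix (same generation): the dimension-`k` instance and `PatternPos k` from rectangle certificates -/

/-- The bilinear (slice) form of the pattern functional in its own dimension: `sStarD U B C = Σ_{q∈B∩C} λ_U(q) − Σ_{q∈B, r∈C} Θ_U(q,r)`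
(the expansion used in `sStarD_le_diag`, recorded as an identity). [this work] -/
theorem sStarD_eq_sum_lamU_sub_sum_thetaVal (U B C : Finset (Pd k)) :
    sStarD U B C = (∑ q ∈ B ∩ C, lamU U q) - ∑ q ∈ B, ∑ r ∈ C, thetaVal U q r := by
  have hswap : sStarD U B C = ∑ q ∈ B, ∑ r ∈ C, ∑ p ∈ U, tcD p q r := by
    rw [sStarD_eq_sum_tcD, Finset.sum_comm]
    refine Finset.sum_congr rfl fun q _ => ?_
    rw [Finset.sum_comm]
  rw [hswap]
  have hpt : ∀ q ∈ B, (∑ r ∈ C, ∑ p ∈ U, tcD p q r) =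
      ∑ r ∈ C, ((if q = r then 2 * (2 : ℤ) ^ k * ind U q - (nuCount U q : ℤ) else 0) - thetaVal U q r) :=
    fun q _ => Finset.sum_congr rfl fun r _ => sliceForm_eq U q r
  rw [Finset.sum_congr rfl hpt]
  unfold lamU
  rw [← sum_sum_ite_eq_diag B C (fun q => 2 * (2 : ℤ) ^ k * ind U q - (nuCount U q : ℤ)), ← Finset.sum_sub_distrib]
  exact Finset.sum_congr rfl fun q _ => Finset.sum_sub_distrib _ _

/-- **A rectangle certificate proves goodness in the slot's own dimension** (the `n = 0` instance, stated without the cylinder):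
hypotheses (ii), (iii) of `(†⁺)_k(U)` alone give `0 ≤ sStarD U B C` for all up-sets `B, C ⊆ [3]^k`. [this work] -/
theorem sStarD_nonneg_of_rectCert (U : Finset (Pd k)) (h : Pd k → Pd k → ℤ)
    (hT : ∀ A A' : Finset (Pd k), IsUpperSet (A : Set (Pd k)) → IsUpperSet (A' : Set (Pd k)) →
      (∑ q ∈ A, ∑ r ∈ A', h q r) ≤ ∑ q ∈ A ∩ A', lamU U q)
    (hN : ∀ A A' : Finset (Pd k), IsUpperSet (A : Set (Pd k)) → IsUpperSet (A' : Set (Pd k)) →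
      (∑ q ∈ A, ∑ r ∈ A', thetaVal U q r) ≤ ∑ q ∈ A, ∑ r ∈ A', h q r)
    {B C : Finset (Pd k)} (hB : IsUpperSet (B : Set (Pd k))) (hC : IsUpperSet (C : Set (Pd k))) :
    0 ≤ sStarD U B C := by
  rw [sStarD_eq_sum_lamU_sub_sum_thetaVal]
  have h1 := hT B C hB hC
  have h2 := hN B C hB hC
  linarith

/-- **`PatternPos k` from rectangle certificates**: if EVERY up-set `U ⊆ [3]^k` admits an `h` with the two rectangle-copositivity properties
(ii), (iii) of `(†⁺)_k`, then `PatternPos k` holds — and, by `sStarD_cylSet_nonneg_of_rectCert` (with (i) `h ≥ 0`), every `U × [3]^n` is then a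
good first slot in every dimension.  (So '`(†⁺)_k(U)` for all up-sets `U` and all `k`' implies `PatternPos d` for all `d`, hence Kahn's Conjecture 5 via
`kahnConjecture_of_forall_patternPos`; the certificates themselves are finite objects to be supplied per `U`.) [this work] -/
theorem patternPos_of_forall_rectCert
    (hall : ∀ U : Finset (Pd k), IsUpperSet (U : Set (Pd k)) → ∃ h : Pd k → Pd k → ℤ,
      (∀ A A' : Finset (Pd k), IsUpperSet (A : Set (Pd k)) → IsUpperSet (A' : Set (Pd k)) →
        (∑ q ∈ A, ∑ r ∈ A', h q r) ≤ ∑ q ∈ A ∩ A', lamU U q) ∧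
      (∀ A A' : Finset (Pd k), IsUpperSet (A : Set (Pd k)) → IsUpperSet (A' : Set (Pd k)) →
        (∑ q ∈ A, ∑ r ∈ A', thetaVal U q r) ≤ ∑ q ∈ A, ∑ r ∈ A', h q r)) :
    PatternPos k := by
  intro A B C hA hB hC
  obtain ⟨h, hT, hN⟩ := hall A hA
  exact sStarD_nonneg_of_rectCert A h hT hN hB hC


/-! ### Appendix 2 (same generation): the certificate notion is instantiable — the whole cube `U = ⊤` with `h = Θ_⊤` (coefficientwise Harris) -/

/-- For the whole cube, `Θ_⊤(q,r) = [q δ̸ r]`. [this work] -/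
theorem thetaVal_univ (q r : Pd k) : thetaVal (univ : Finset (Pd k)) q r = if TotDist q r = true then 1 else 0 := by
  unfold thetaVal ind
  simp only [mem_univ, if_true]
  split_ifs <;> norm_num

/-- For the whole cube, `λ_⊤(q) = 2^k` (`2^{k+1}` minus the `2^k` points totally distinct from `q`). [this work] -/
theorem lamU_univ (q : Pd k) : lamU (univ : Finset (Pd k)) q = 2 ^ k := by
  unfold lamU ind nuCount
  have h2 : ((univ.filter fun p : Pd k => TotDist p q = true).card : ℤ) = 2 ^ k := by
    rw [← sum_ite_totDist_eq_pow q, Finset.sum_boole]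
  rw [if_pos (mem_univ q), h2]
  ring

/-- **The hypotheses of `sStarD_cylSet_nonneg_of_rectCert` are satisfiable**: for `U = ⊤` the choice `h = Θ_⊤ = [q δ̸ r]` is a rectangle certificate —
(i) `h ≥ 0`, (iii) with equality, and (ii) `#{(q,r) ∈ A×A′ : q δ̸ r} ≤ 2^k #(A ∩ A′)` is coefficientwise Harris (`tdPairs_le_card_inter`).  (More generally
every `(†)_k` certificate of generation 11 is a `(†⁺)_k` certificate, a `K*⊗K*` element being nonnegative on up-set rectangles.) [this work] -/
theorem rectCert_univ_T (A A' : Finset (Pd k)) (hA : IsUpperSet (A : Set (Pd k))) (hA' : IsUpperSet (A' : Set (Pd k))) :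
    (∑ q ∈ A, ∑ r ∈ A', thetaVal (univ : Finset (Pd k)) q r) ≤ ∑ q ∈ A ∩ A', lamU (univ : Finset (Pd k)) q := by
  have hH := tdPairs_le_card_inter A A' hA hA'
  have hL : (∑ q ∈ A, ∑ r ∈ A', thetaVal (univ : Finset (Pd k)) q r) =
      (((A ×ˢ A').filter fun pq => TotDist pq.1 pq.2 = true).card : ℤ) := by
    simp_rw [thetaVal_univ]
    rw [Finset.card_filter, Nat.cast_sum, Finset.sum_product]
    refine Finset.sum_congr rfl fun q _ => Finset.sum_congr rfl fun r _ => ?_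
    split_ifs <;> simp
  have hR : (∑ q ∈ A ∩ A', lamU (univ : Finset (Pd k)) q) = 2 ^ k * ((A ∩ A').card : ℤ) := by
    simp_rw [lamU_univ]
    rw [Finset.sum_const, nsmul_eq_mul]
    ring
  rw [hL, hR]
  exact hH

/-- The whole-cube cylinder `⊤ × [3]^n` is a good first slot in every dimension, DERIVED THROUGH THE RECTANGLE-CERTIFICATE THEOREM with `h = Θ_⊤`
(of course also directly: it is the Harris slack; the point is the instantiation of `sStarD_cylSet_nonneg_of_rectCert`). [this work] -/
theorem sStarD_cylSet_univ_nonneg_of_rectCert {B C : Finset (Pd (n + k))} (hB : IsUpperSet (B : Set (Pd (n + k))))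
    (hC : IsUpperSet (C : Set (Pd (n + k)))) : 0 ≤ sStarD (cylSet (univ : Finset (Pd k)) : Finset (Pd (n + k))) B C :=
  sStarD_cylSet_nonneg_of_rectCert (univ : Finset (Pd k)) (thetaVal (univ : Finset (Pd k)))
    (fun q r => by rw [thetaVal_univ]; split_ifs <;> norm_num) (fun A A' hA hA' => rectCert_univ_T A A' hA hA') (fun _ _ _ _ => le_rfl) hB hC

end Summit.CriticalPhenomena.PercolationContinuityZ3.Theorems.SahiGridPattern
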